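import Summits.Schanuel.Schanuel.Theorems.RootDecomp1HProductCells
import Summits.Schanuel.Schanuel.Theorems.MinimalCounterexampleInAcl.Negative.KhovanskiiPoint

/-!
# RootDecomp1H — support item `StarLocalisation` (stmt-Schanuel-27288): the c⋆-localisation

A first failure `x` with conjugation-stable span has, in its own rank, a near c⋆-optimal conjugation-stable
first failure `y`: a basis tuple of `span_ℚ x` presented (non-degenerate Khovanskii point of a size-`≤ c` system)
inside the ball `‖y‖ ≤ 4^c` at the LEAST such `c`.  Proof (lens-5 g2 node «ConjugateCells», `starLocalisation_holds`):
a first failure is presented at some size (Khovanskii dichotomy + Ax 1971, the landed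
`MinimalCounterexampleInAcl.Negative.firstFailure_khovanskii` [cite: Kirby2010, Lemma 4.8, Prop. 7.2] [cite: Ax1971, Thm. 3]);
the radius `4^c` is unbounded, so `x` itself near-presents its span at some `c`; take the least `c` (`Nat.find`)
and a near presentation `y` there; first-failure-ness (`trdeg_lt_of_span_eq`, landed with the 1H glue) and
conjugation-stability are properties of the span.  Census seat (prover role); this file defines nothing; 0 sorry.
-/

noncomputable section

set_option linter.dupNamespace false

namespace Summit.Schanuel.Schanuel.Theorems.RootDecomp1HStarLocalisation

open Complex
open Summit.Schanuel.Schanuel.Theses.RootDecomp1H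
open Summit.Schanuel.Schanuel.Theorems.RootDecomp1HProductCells (trdeg_lt_of_span_eq)

variable {n : ℕ}

/-- ℚ-independence of an `n`-tuple is a property of its span (dimension `n`). -/
theorem linearIndependent_of_span_eq {x y : Fin n → ℂ} (h : Submodule.span ℚ (Set.range x) = Submodule.span ℚ (Set.range y))
    (hx : LinearIndependent ℚ x) : LinearIndependent ℚ y := by
  rw [linearIndependent_iff_card_eq_finrank_span] at hx ⊢
  rw [hx]
  show Module.finrank ℚ (Submodule.span ℚ (Set.range x)) = Module.finrank ℚ (Submodule.span ℚ (Set.range y))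
  rw [h]

/-- Conjugation-stability is a property of the span. -/
theorem conjStable_of_span_eq {x y : Fin n → ℂ} (h : Submodule.span ℚ (Set.range x) = Submodule.span ℚ (Set.range y))
    (hx : ∀ j, (starRingEnd ℂ) (x j) ∈ Submodule.span ℚ (Set.range x)) :
    ∀ j, (starRingEnd ℂ) (y j) ∈ Submodule.span ℚ (Set.range y) := by
  let σ : ℂ →ₗ[ℚ] ℂ := (starRingEnd ℂ).toRatAlgHom.toLinearMap
  have hmap : (Submodule.span ℚ (Set.range x)).map σ ≤ Submodule.span ℚ (Set.range x) := by
    rw [Submodule.map_span, Submodule.span_le, ← Set.range_comp]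
    rintro _ ⟨j, rfl⟩
    exact hx j
  intro j
  have hy : y j ∈ Submodule.span ℚ (Set.range x) := h ▸ Submodule.subset_span ⟨j, rfl⟩
  have := hmap (Submodule.mem_map_of_mem hy)
  rw [h] at this
  exact this

/-- Item stmt-Schanuel-27288 (`StarLocalisation`, support r9 of route-Schanuel-RootDecomp1H): the c⋆-localisation;
the only transcendence input is «a first failure is presented at some size» = the landed `firstFailure_khovanskii`
(Khovanskii dichotomy + Ax 1971), the rest is span bookkeeping and `Nat.find`. -/
theorem starLocalisation_holds : StarLocalisation := by
  classical
  intro n x hx hcs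
  -- `x` is presented: a non-degenerate Khovanskii point of some size-`≤ c₀` system
  obtain ⟨g₀, hzero₀, hdet₀⟩ :=
    Summit.Schanuel.Schanuel.Theorems.MinimalCounterexampleInAcl.Negative.firstFailure_khovanskii hx.2.1 hx.2.2 hx.1
  set c₀ : ℕ := Finset.univ.sup fun i => max (g₀ i).totalDegree
    ((g₀ i).support.sup fun m => max ((g₀ i).coeff m).num.natAbs ((g₀ i).coeff m).den) with hc₀
  have hsz₀ : ∀ i, max (g₀ i).totalDegree
      ((g₀ i).support.sup fun m => max ((g₀ i).coeff m).num.natAbs ((g₀ i).coeff m).den) ≤ c₀ := fun i =>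
    Finset.le_sup (f := fun i => max (g₀ i).totalDegree
      ((g₀ i).support.sup fun m => max ((g₀ i).coeff m).num.natAbs ((g₀ i).coeff m).den)) (Finset.mem_univ i)
  -- the span of `x` is near-presented at some `c` (by `x` itself: the radius `4^c` is unbounded)
  have hex : ∃ c : ℕ, ∃ y' : Fin n → ℂ, Submodule.span ℚ (Set.range x) = Submodule.span ℚ (Set.range y') ∧ (∃ g' : Fin n → MvPolynomial (Fin n ⊕ Fin n) ℚ, (∀ i, max (g' i).totalDegree ((g' i).support.sup fun m => max ((g' i).coeff m).num.natAbs ((g' i).coeff m).den) ≤ c) ∧ (∀ i, MvPolynomial.aeval (Sum.elim y' (Complex.exp ∘ y')) (g' i) = 0) ∧ (Matrix.of fun i j => MvPolynomial.aeval (Sum.elim y' (Complex.exp ∘ y')) (Literature.NumberTheory.Transcendental.Khovanskii.ePD j (g' i))).det ≠ 0) ∧ ‖y'‖ ≤ ((4 ^ c : ℕ) : ℝ) := by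
    refine ⟨max c₀ ⌈‖x‖⌉₊, x, rfl, ⟨g₀, fun i => (hsz₀ i).trans (le_max_left _ _), hzero₀, hdet₀⟩, ?_⟩
    have h1 : ‖x‖ ≤ (⌈‖x‖⌉₊ : ℝ) := Nat.le_ceil _
    have h2 : ⌈‖x‖⌉₊ ≤ max c₀ ⌈‖x‖⌉₊ := le_max_right _ _
    have h3 : max c₀ ⌈‖x‖⌉₊ ≤ 4 ^ (max c₀ ⌈‖x‖⌉₊) :=
      (Nat.lt_two_pow_self).le.trans (Nat.pow_le_pow_left (by norm_num) _)
    calc ‖x‖ ≤ (⌈‖x‖⌉₊ : ℝ) := h1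
      _ ≤ ((4 ^ (max c₀ ⌈‖x‖⌉₊) : ℕ) : ℝ) := by exact_mod_cast h2.trans h3
  -- the least such `c` and a near presentation `y` of the span there
  obtain ⟨y, hxy, hpres, hnorm⟩ := Nat.find_spec hex
  refine ⟨Nat.find hex, y, ⟨hx.1, linearIndependent_of_span_eq hxy hx.2.1, trdeg_lt_of_span_eq hxy hx.2.2⟩,
    conjStable_of_span_eq hxy hcs, ⟨hpres, hnorm⟩, ?_⟩
  intro c' hc' hbad
  refine Nat.find_min hex hc' ?_
  obtain ⟨y', hyy', hg', hn'⟩ := hbad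
  exact ⟨y', hxy.trans hyy', hg', hn'⟩

end Summit.Schanuel.Schanuel.Theorems.RootDecomp1HStarLocalisation

end
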